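import Summits.BirchSwinnertonDyer.Rank1Residual.Additive.X4KimLargeImageLevelKRankOne
import Summits.BirchSwinnertonDyer.Rank1Residual.Additive.KimStructureOfFiveLe
import HarnessLib

/-!
# The rank-ONE LEVEL-`k` Kurihara shape at `p ≥ 5` from the PUBLISHED structure theorem
# (Kim 2026 Thm. 1.8 (6) — harvest-2's E73 fact), instantiated BY NAME over the T-a4-LK shapes
# (cell `b2b-bsdres`, team n1011, seat p11, OWNERS row T-a4-LK, `p ≥ 5` twin; lead GEN 5 R5-22: "E73 LANDED — instantiate BY NAME")

HONEST FRAMING (cell `b2b-bsdres`, run/shared/lean/b2b/bsd-rank1-residual/, verbatim in every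
file): the goal of the cell is to DELETE the COMBINATION-SHAPED residual classes of the
Birch–Swinnerton-Dyer formula for ALL analytic-rank `≤ 1` elliptic curves over `ℚ` — "full BSD
formula for every rank `≤ 1` curve in class `C`" assembled STRICTLY from published theorems — so
that the rank-`≤ 1` remainder becomes exactly the CONSTRUCTION-SHAPED classes, which are TYPED
(missing-input `Prop`s), NOT attempted. This is not "finishing BSD". Team n1011 is a RESEARCH ROUTE;
no claim beyond the stated classes; no label or mark is changed by this file; nothing is booked.
THEOREMS ONLY (no definition, no `@[conjecture]`, no named fact minted); per pair; NOT class theorems.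
NO preprint here: the input `hE73 : Kim2026.kuriharaPartial_vanishingOrder_eq_padicValNat_sha_add_partialInfty_of_maninConstant`
is the PUBLISHED Kim, Amer. J. Math. 148 (2026) Thm. 1.8 (6) in `∂`-currency (harvest-2,
`Literature/…/Kim2026/ShaLengthStructure.lean`, p253834; flag `Kim2026-(6)-cyclic-reading`), and
`kimRankOnePartialAt_of_kim2026_of_five_le` (harvest-2, `Additive/KimStructureOfFiveLe.lean`, p254169)
turns it into p17's rank-one `∂`-predicate `KimRankOnePartialAt W p` at `p ≥ 5` — consumed BY NAME.

## What this file does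

File 1 (`X4KimLargeImageLevelKRankOne.lean`) §2 proved the Tamagawa-free LEVEL-`k` SHAPE from
`KimRankOnePartialAt W p` alone: a Kurihara number non-zero modulo `p^k` at a cyclic Kolyvagin prime
`ℓ ∈ 𝒫_k(E,p)` gives `ord_p #Ш(E/ℚ)(p) + ∂^{(∞)}(δ̃) ≤ k − 1`, in particular `ord_p #Ш(E/ℚ)(p) ≤ k − 1`.
At `p ≥ 5` with `ρ̄_{E,p}` onto, `KimRankOnePartialAt W p` IS A THEOREM (E73), the tower binder is
Serre's theorem (`serre_hasSurjectiveModNGaloisRep_pow_holds`), so: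

* `rankOne_sha_val_add_partialInfty_le_of_kim2026_of_levelK_of_five_le`,
  `rankOne_sha_val_le_of_kim2026_of_levelK_of_five_le` — **PUBLISHED-input level-`k` shape at `p ≥ 5`**
  (`p ≥ 5`, surj(`p`), `L(E,1) = 0`, `r_an = 1`, `Ш(E/ℚ)` finite, datum `D` with `p ∤ c_D` and the
  period transfer, `k ≥ 1`, a cyclic `ℓ ∈ 𝒫_k` with `kuriharaNumber D.f (p^k) ℓ ψ ≠ 0` ⟹
  `ord_p #Ш(E/ℚ)(p) ≤ k − 1`): the general-`k` form of the tree's two published certificate facts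
  (`k = 1`: `Kim2022_rankOne_card_sha_eq_one_of_kuriharaNumber_ne_zero_of_maninConstant`; `k = 2`:
  `Kim2022_rankOne_padicValNat_sha_le_one_of_kuriharaNumber_levelTwo_ne_zero_of_maninConstant`), now
  for EVERY `k` — e.g. p17's 835 X4 ∧ surj ∧ `r = 1` pairs at `p ≥ 5`. (The TAM composition at `p ≥ 5`
  is harvest-2's `card_primaryComponent_eq_one_of_kim2026_of_tamagawaDefectGe_of_five_le`, not restated.)

References: Kim 2026 [Kim2022StructureSelmer] Thm. 1.9 (1), (4), (6), §1.5.1; Serre 1972 [Serre1972]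
IV §3.4; cells/n1011/PLAN.md R5-22.
-/

noncomputable section

open scoped Classical MatrixGroups ModularForm

open CongruenceSubgroup WeierstrassCurve Literature.NumberTheory.EllipticCurves
  Literature.NumberTheory.EllipticCurves.ModularForms
  Literature.NumberTheory.EllipticCurves.Rank1Residual
  Literature.NumberTheory.EllipticCurves.Rank1Residual.Typed

namespace Summit.BirchSwinnertonDyer.Rank1Residual.Additive

variable (W : WeierstrassCurve ℚ) [W.IsElliptic] [W.IsGloballyMinimal] (p : ℕ) [hp : Fact p.Prime]

/-- **`p ≥ 5`, PUBLISHED input: `ord_p #Ш(E/ℚ)(p) + ∂^{(∞)}(δ̃) ≤ k − 1` from ONE level-`k` prime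
certificate** in analytic rank one: E73 (`hE73`, Kim 2026 Thm. 1.8 (6) as printed) gives
`KimRankOnePartialAt W p` (`kimRankOnePartialAt_of_kim2026_of_five_le`, BY NAME), the tower is
Serre's theorem, then file 1's `rankOne_sha_val_add_partialInfty_le_of_partial_of_levelK`.
[cite: Kim2022StructureSelmer, Thm. 1.9 (1), (4), (6), §1.5.1 (PDF pp. 7–8)] [cite: Serre1972, IV §3.4 Lemme 3] -/
theorem rankOne_sha_val_add_partialInfty_le_of_kim2026_of_levelK_of_five_le
    (hE73 : Kim2026.kuriharaPartial_vanishingOrder_eq_padicValNat_sha_add_partialInfty_of_maninConstant)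
    (hp5 : 5 ≤ p) (hsurj : W.HasSurjectiveModNGaloisRep p) (hL : W.entireLFunction 1 = 0)
    (hr : W.analyticRank = 1) (hfin : Finite W.sha)
    {N : ℕ} [NeZero N] (D : ModularParametrizationData W N) (hc : ¬ (p : ℤ) ∣ D.maninConstant)
    (hper : ∃ u : ℚ, ‖(u : ℚ_[p])‖ = 1 ∧ W.realPeriodRat = u * plusPeriod D.f)
    {k : ℕ} (hk : 1 ≤ k) (ℓ : ℕ) [Fact ℓ.Prime] (hℓ : Kato.IsKolyvaginPrime W p k ℓ)
    (hcyc : Nat.card {P : ((WeierstrassCurve.integralModelInt W).map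
        (Int.castRingHom (ZMod ℓ))).toAffine.Point // p • P = 0} ≤ p)
    (ψ : (ℓ' : ℕ) → (ZMod ℓ')ˣ →* Multiplicative (ZMod (p ^ k)))
    (hψ : Function.Surjective (ψ ℓ)) (hδ : kuriharaNumber D.f (p ^ k) ℓ ψ ≠ 0) :
    (padicValNat p (Nat.card (AddCommGroup.primaryComponent W.sha p)) : ℕ∞) +
        kuriharaPartialInfty W p D.f ≤ ((k - 1 : ℕ) : ℕ∞) :=
  rankOne_sha_val_add_partialInfty_le_of_partial_of_levelK W p
    (kimRankOnePartialAt_of_kim2026_of_five_le W p hE73 hp5) hsurj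
    (serre_hasSurjectiveModNGaloisRep_pow_holds W p hp5 hsurj) hL hr hfin D hc hper hk ℓ hℓ hcyc ψ hψ hδ

/-- **`p ≥ 5`, PUBLISHED input: the LEVEL-`k` SHAPE `ord_p #Ш(E/ℚ)(p) ≤ k − 1`** in analytic rank one
from ONE Kurihara number non-zero modulo `p^k` at a cyclic Kolyvagin prime of level `k` — the
general-`k` form of the tree's published `k = 1` / `k = 2` certificate facts, via E73 BY NAME.
[cite: Kim2022StructureSelmer, Thm. 1.9 (1), (4), (6), §1.5.1 (PDF pp. 7–8)] [cite: Serre1972, IV §3.4 Lemme 3] -/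
theorem rankOne_sha_val_le_of_kim2026_of_levelK_of_five_le
    (hE73 : Kim2026.kuriharaPartial_vanishingOrder_eq_padicValNat_sha_add_partialInfty_of_maninConstant)
    (hp5 : 5 ≤ p) (hsurj : W.HasSurjectiveModNGaloisRep p) (hL : W.entireLFunction 1 = 0)
    (hr : W.analyticRank = 1) (hfin : Finite W.sha)
    {N : ℕ} [NeZero N] (D : ModularParametrizationData W N) (hc : ¬ (p : ℤ) ∣ D.maninConstant)
    (hper : ∃ u : ℚ, ‖(u : ℚ_[p])‖ = 1 ∧ W.realPeriodRat = u * plusPeriod D.f)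
    {k : ℕ} (hk : 1 ≤ k) (ℓ : ℕ) [Fact ℓ.Prime] (hℓ : Kato.IsKolyvaginPrime W p k ℓ)
    (hcyc : Nat.card {P : ((WeierstrassCurve.integralModelInt W).map
        (Int.castRingHom (ZMod ℓ))).toAffine.Point // p • P = 0} ≤ p)
    (ψ : (ℓ' : ℕ) → (ZMod ℓ')ˣ →* Multiplicative (ZMod (p ^ k)))
    (hψ : Function.Surjective (ψ ℓ)) (hδ : kuriharaNumber D.f (p ^ k) ℓ ψ ≠ 0) :
    padicValNat p (Nat.card (AddCommGroup.primaryComponent W.sha p)) ≤ k - 1 :=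
  rankOne_sha_val_le_of_partial_of_levelK W p (kimRankOnePartialAt_of_kim2026_of_five_le W p hE73 hp5)
    hsurj (serre_hasSurjectiveModNGaloisRep_pow_holds W p hp5 hsurj) hL hr hfin D hc hper hk ℓ hℓ hcyc
    ψ hψ hδ

end Summit.BirchSwinnertonDyer.Rank1Residual.Additive

end
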